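import Summits.ResolutionOfSingularities.ResolutionOfSingularities.Theorems.HilbertSamuelEliminationCampaignW42TertiaryCorridor3
import Summits.ResolutionOfSingularities.ResolutionOfSingularities.Theorems.HilbertSamuelEliminationCampaignW42TertiaryGenuine
import Summits.ResolutionOfSingularities.ResolutionOfSingularities.Theorems.HilbertSamuelEliminationCampaignW42TertiaryReduction
import Summits.ResolutionOfSingularities.ResolutionOfSingularities.Theorems.HilbertSamuelEliminationCampaignW42NearChain
import Summits.ResolutionOfSingularities.ResolutionOfSingularities.Theorems.HilbertSamuelEliminationSigmaMaxModificationsCorridor3WLadder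
import Literature.AlgebraicGeometry.CossartJannsenSaito2020.KeyTheoremsIsolated
import Literature.AlgebraicGeometry.Resolution.DirectrixScheme
import HarnessLib

/-!
# [OURS · L1 W4.2] MODULE `Corridor3WLadderMoving` (crux chain w42, helpers v3.6, CHAIN v3.7) — the MOVING W-ladder
# — part 1/3: the DEFINITIONS (rows, predicates, bridges)

PROVENANCE / SPLIT FOR THE GATE (typer res-type-053, res-L1-w42-plan-1 TAKE + TYPING-WANTED 2026-08-27T04:09:15Z): the three
tree modules `…Corridor3WLadderMovingDefs` (every DEFINITION, in the original order), `…Corridor3WLadderMoving` (the PROVED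
reductions of §1–§3c) and `…Corridor3WLadderMovingRows` (the PROVED reductions of §MD) land plan-1's helpers v3.6
`HOME/L/w42/Corridor3WLadderMoving.lean` (sha16 `5411d44e07615426`, 785 l.) with every declaration BYTE-IDENTICAL and in the SAME
namespace `…Theorems.SigmaMaxModificationsCorridor3.Moving` (so the registered stub signatures of skeleton `w_ladder` v5 keep
their constant names): the gate caps Theorems files with proofs at 400 lines and relocates tagged parameterless `def : Prop`s of
Theorems files to Literature/, hence defs are hoisted into the `…Defs` module and the three PARAMETERLESS `Prop`s
`MovingCompactness`, `WA3M`, `WB3M` carry their CJS pointers in prose instead of a `[cite: …]` tag (OURS nodes, not citations of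
print); eight theorems that had no docstring in v3.6 received one-line docstrings (`dirDim_le_geomDirDim`, the six §MD.1
`…M_of_…` transfers, `bridge3SeqM_of_bridge3Seq`). Nothing else differs. `import …Corridor3WLadderMovingRows` gives all three.
idea-2's / plan-1's module docstring follows unchanged.


PROVENANCE. §1–§3c = res-L1-w42-idea-2 (gen 3) `Sketch-L1-idea-2-r3b.lean` sha16 469e366b809bf0b0, VERBATIM except the namespace
(`…Cruxes.SigmaMaxModifications.IdeasL1Idea2R3b` ↦ `…Theorems.SigmaMaxModificationsCorridor3.Moving`, so that the registered stub
signatures of skeleton `w_ladder` v5 keep their constant names when this module lands under `Theorems/`); §MD = res-L1-w42-plan-1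
(gen 5): the five moving rows BY NAME (`Wlow3CharM`, `Wlow3TwoM` (+β/γ), `Wtop3PointedM`, `Wtop3NonpointedM`), joins, `WB3M_of_rows5`,
the (F1)-regime isolation-recurrence cut, the graded moving bridges. Landing target (typer, `--supports stmt-…-19249`, as helper):
`Summits/ResolutionOfSingularities/ResolutionOfSingularities/Theorems/HilbertSamuelEliminationSigmaMaxModificationsCorridor3WLadderMoving.lean`.
idea-2's original module docstring follows unchanged.

# [OURS · L1 W4.2] Sketch-L1-idea-2 — ROUND 3b: LIVENESS IS FREE — type the W-rows MOVING
# (`NoMovingNearChainFrom`), calibrated by ONE provable compactness lemma `MovingCompactness` (L∞);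
# the isolation-recurrence split of round 3 restated for moving chains

OURS (cell res-hironaka, slot W4.2, crux chain w42, IDEATOR res-L1-w42-idea-2 gen 3); NOT statements of the manuscript
[Hironaka2017]; AI ideation, weaker than expert review. Every `theorem` below is PROVED; the open content sits in `def … : Prop` rows.

## The defect this file repairs (HOSTAGE-BY-STARVATION of every `NoNearChainFrom`-typed W-row)

The tree's `CanonicalNearStep` admits WAITING steps (centre disjoint from the marked point; the marked point is carried along
isomorphically), and the tree's canonical rule (`IsCanonicalStep`, CJS Rem. 6.29 (1) / Step 7 p. 95) treats the LEAST label first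
while components born over POINT centres INHERIT the label (`Labelling.next`, «dominates ⇒ inherits»). Hence an infinite lineage of
label `j` (e.g. an infinite chain of point blow-ups, all inheriting `j`) STARVES for ever every component of label `> j` born later
(e.g. an isolated near point born over a curve centre): such a point carries an infinite WAITING chain of any grade you like. So a
row «no infinite `ē ≤ 2` chain from maximal origins» typed with `NoNearChainFrom` (the chain's `Helpers.ClosedOriginNoNearChainAt`,
`stub_Wlow3`, and round 3's `WlowUnits` / `WlowStrata`) is FALSE on any `X` that ALSO carries an infinite older lineage of grade 3 —
each such row is hostage to all the others (morally equivalent to the whole corridor-3 termination), and a bridge like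
`UnitTowerExtraction` / `Helpers.Bridge3` can never be built from a waiting chain. The tree already has the right notion:
`MarkedStage.IsBlownUp` / `NoMovingNearChainFrom` (…CampaignW42Tertiary): a MOVING chain is blown up infinitely often.

## The repair: L∞ (`MovingCompactness`) — an infinite `S(X, ν)` carries a MOVING chain of closed near points

PROOF SKETCH (tree-internal, no geometry beyond what `exists_persistent_closedPt` already uses; M-sized): each resolution cycle is
finite (the replayed lower-dimensional sequence is a finite list), so an infinite run has infinitely many cycles; the label `j_k`
treated by cycle `k` is the least non-empty label, an extinct label never reappears (labels are inherited only from present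
components), so `j_k` is non-decreasing. CASE A (`j_k` eventually constant `= j`): at every later cycle start `Y^{(j)} ≠ ∅`, and every
label-`j` component at cycle `k+1` DOMINATES a label-`j` component of the centre `Y^{(j)}` of cycle `k` (strict transforms under the
replay steps keep the label and stay inside the stratum by upper semicontinuity + maximality of `ν`); finitely many components per
stage ⇒ KŐNIG ON THE COMPONENT FOREST (finitely branching!) gives an infinite domination lineage `Z_k ← Z_{k+1} ← ⋯`; dominations of
proper maps are surjective, so CLOSED points thread: `z_{k+1} ∈ Z_{k+1}` closed over `z_k` — a chain of closed near points blown up at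
every cycle end (`z_k ∈ Z_k ⊆` centre): MOVING; prepend the images of `z_{k₀}` down to `X` (closed, in the `ν`-strata since `H` does not
increase upwards and `ν` is maximal). CASE B (`j_k → ∞`): a chain waiting for ever from stage `n` on sits on a persisting component of
fixed label `ℓ` (idle steps move neither the point nor its component's label), forcing `j_k ≤ ℓ` — so in case B EVERY infinite near
chain is moving, and the tree's `exists_nearChain_of_canonicalSequenceInfinite_general` supplies one.

With L∞ the whole W-ladder can be typed with `NoMovingNearChainFrom` — STRICTLY WEAKER rows (tree `NoNearChainFrom.noMoving`),
immune to starvation elsewhere, and calibrated against `SigmaMaxModificationsCorridor3` by the PROVED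
`sigmaMaxModificationsCorridor3_of_noMovingNearChains` below (the landed calibration with its single use of compactness swapped).

References: CJS LNM 2270 Rem. 6.29 (1), Step 7 p. 95, p. 105, p. 107 [CossartJannsenSaito2020]; tree …CampaignW42Tertiary
(`IsBlownUp`, `NoMovingNearChainFrom`, `StratumLiveness`), …TertiaryCompactnessGeneral (`exists_persistent_closedPt`,
`exists_nearChain_of_canonicalSequenceInfinite_general`), …TertiaryGeneralStrata / …TertiaryCorridor3 (the landed calibration),
`Literature…CanonicalEliminationSequence` (`IsCanonicalStep`, `Labelling.next`).
-/

noncomputable section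

-- plan-1/idea-2 module setting kept verbatim (namespace `…Corridor3.Moving` re-enters `…Corridor3`)
set_option linter.dupNamespace false

open CategoryTheory AlgebraicGeometry TopologicalSpace
open Summit.ResolutionOfSingularities.ResolutionOfSingularities.Theorems.CampaignW42
open Literature.AlgebraicGeometry.Resolution Literature.RingTheory.HilbertSamuel
open Literature.AlgebraicGeometry.CossartJannsenSaito2020
open Summit.ResolutionOfSingularities.ResolutionOfSingularities.Theses.HilbertSamuelElimination
open Summit.ResolutionOfSingularities.ResolutionOfSingularities.Theorems.SigmaMaxModificationsCorridor3

namespace Summit.ResolutionOfSingularities.ResolutionOfSingularities.Theorems.SigmaMaxModificationsCorridor3.Moving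

universe u

variable {R : ∀ S : Scheme.{u}, CentreSeq S → Prop} {N : ℕ} {ν : ℕ → ℕ}

/-! ## §1. L∞ — MOVING COMPACTNESS (typed; provable by the label argument of the module docstring) -/

/-- [OURS · L1 W4.2] **L∞ (MovingCompactness).** From a good initial state with a functional oracle, an INFINITE `S(X, ν)` carries
an infinite chain of closed near points from some closed point of `X(ν)` whose marked point is BLOWN UP INFINITELY OFTEN — the
moving sharpening of the tree's `exists_nearChain_of_canonicalSequenceInfinite_general`. Provable now (Case A: Kőnig on the
finitely-branching forest of least-label components + threading closed points through surjective dominations; Case B: least label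
`→ ∞` forces every chain to move). Size M. Why it might fail: only a mis-reading of `Labelling.next` (which components inherit).
OURS node (cf. CJS LNM 2270 Rem. 6.29 (1), p. 95, p. 105, p. 107); not a citation of print; not asserted. -/
def MovingCompactness : Prop :=
  ∀ (k : Type u) [Field k] (R : ∀ S : Scheme.{u}, CentreSeq S → Prop), OracleFunctional R →
  ∀ (N : ℕ) (ν : ℕ → ℕ) (X : Scheme.{u}) [IsLocallyNoetherian X],
    StateGood k R N ν X (Labelling.init X) none → CanonicalSequenceInfinite R N ν X →
    ∃ (x : X) (c : ℕ → MarkedStage.{u}), x ∈ Scheme.hsStratum X N ν ∧ IsClosed ({x} : Set X) ∧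
      c 0 = MarkedStage.init X x ∧ (∀ n, CanonicalNearStep R N ν (c n) (c (n + 1))) ∧
      ∀ n, ∃ m, n ≤ m ∧ (c m).IsBlownUp R N ν

/-! ## §3. The W-rows typed MOVING, and the isolation-recurrence split for moving chains -/

/-- [OURS] «No MOVING chain of canonical near steps of grade `G` from any maximal origin of characteristic `p` at level `N`» — the
chain's row functional re-typed with the tree's `NoMovingNearChainFrom` (starvation-immune). [folklore] -/
def MaxOriginNoMovingNearChainAt (p N : ℕ) (G : MarkedStage.{u} → Prop) : Prop :=
  ∀ (R : ∀ S : Scheme.{u}, CentreSeq S → Prop), OracleFunctional R → OracleAdmissible R →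
  ∀ (ν : ℕ → ℕ) (X : Scheme.{u}) [IsLocallyNoetherian X] (x : X), IsMaximalOrigin p N ν X x →
    NoMovingNearChainFrom R N ν (MarkedStage.init X x) G

/-- [OURS] «No MOVING `G`-chain from `s₀` visiting `B` infinitely often.» [folklore] -/
def NoMovingRecurrentNearChainFrom (R : ∀ S : Scheme.{u}, CentreSeq S → Prop) (N : ℕ) (ν : ℕ → ℕ)
    (s₀ : MarkedStage.{u}) (G B : MarkedStage.{u} → Prop) : Prop :=
  ¬ ∃ c : ℕ → MarkedStage.{u}, Reaches R N ν s₀ (c 0) ∧ (∀ n, CanonicalNearStep R N ν (c n) (c (n + 1))) ∧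
      (∀ n, G (c n)) ∧ (∀ n, ∃ m, n ≤ m ∧ (c m).IsBlownUp R N ν) ∧ ∀ n, ∃ m, n ≤ m ∧ B (c m)

/-- [OURS] Origin-quantified moving-recurrent row. [folklore] -/
def MaxOriginNoMovingRecurrentNearChainAt (p N : ℕ) (G B : MarkedStage.{u} → Prop) : Prop :=
  ∀ (R : ∀ S : Scheme.{u}, CentreSeq S → Prop), OracleFunctional R → OracleAdmissible R →
  ∀ (ν : ℕ → ℕ) (X : Scheme.{u}) [IsLocallyNoetherian X] (x : X), IsMaximalOrigin p N ν X x →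
    NoMovingRecurrentNearChainFrom R N ν (MarkedStage.init X x) G B

/-! ### §3a. The splitting predicate and the rows of round 3, MOVING -/

/-- [OURS] `s.Iso N`: the marked point is isolated in the Hilbert–Samuel locus of its stage (`IsIsolatedInHSMaxLocus`, p486755).
[cite: CossartJannsenSaito2020, Def. 13.3] -/
def Iso (N : ℕ) (s : MarkedStage.{u}) : Prop :=
  @IsIsolatedInHSMaxLocus s.W s.ln N s.pt

/-- [OURS] `e_{x_n}(X_n)` at the marked point (tree `Scheme.dirDim`). [folklore] -/
def dirDim (s : MarkedStage.{u}) : ℕ :=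
  @Scheme.dirDim s.W s.ln s.pt

/-- [OURS] In scope = reached from a maximal origin. [folklore] -/
def InScopeM (p : ℕ) (R : ∀ S : Scheme.{u}, CentreSeq S → Prop) (N : ℕ) (ν : ℕ → ℕ) (s : MarkedStage.{u}) : Prop :=
  ∃ (X : Scheme.{u}) (h : IsLocallyNoetherian X) (x : X), IsMaximalOrigin p N ν X x ∧ Reaches R N ν (@MarkedStage.init X h x) s

/-- [OURS · L1 W4.2] **W-low MOVING** = the row the ladder should carry: no MOVING `ē ≤ 2` chain from a maximal origin.
[cite: CossartJannsenSaito2020, Thm. 6.35, Thm. 6.40] -/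
def WlowM (p : ℕ) : Prop :=
  MaxOriginNoMovingNearChainAt.{0} p 3 fun s => s.geomDirDim ≤ 2

/-- [OURS · L1 W4.2] **W-top MOVING**: no MOVING `ē = 3` chain from a maximal origin (the open core, starvation-free).
[cite: CossartJannsenSaito2020, p. 107] -/
def WtopM (p : ℕ) : Prop :=
  MaxOriginNoMovingNearChainAt.{0} p 3 fun s => 3 ≤ s.geomDirDim

/-- [OURS · L1 W4.2] **W-low UNITS-half, moving**: no moving `ē ≤ 2` chain from a maximal origin is isolated in the HS-locus
INFINITELY OFTEN (Thm 6.40's content; reduction `wlowUnitsM_of_extraction`). [cite: CossartJannsenSaito2020, Thm. 6.40, Def. 6.38] -/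
def WlowUnitsM (p : ℕ) : Prop :=
  MaxOriginNoMovingRecurrentNearChainAt.{0} p 3 (fun s => s.geomDirDim ≤ 2) (fun s => Iso 3 s)

/-- [OURS · L1 W4.2] **W-low STRATA-half, moving = the interruptions lemma G1′**: no moving `ē ≤ 2` chain from a maximal origin is
non-isolated at EVERY stage (technique B at generic points; see round 3 card). [cite: CossartJannsenSaito2020, Thm. 6.35, Prop. 6.31] -/
def WlowStrataM (p : ℕ) : Prop :=
  MaxOriginNoMovingNearChainAt.{0} p 3 fun s => s.geomDirDim ≤ 2 ∧ ¬ Iso 3 s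

/-- [OURS · L1 W4.2] Low directrix dimension at an isolated in-scope stage kills every MOVING chain (Cor. 6.37 / Thm 3.14).
[cite: CossartJannsenSaito2020, Cor. 6.37, Thm. 3.14] -/
def IsoLowDirDimTerminatesM (p : ℕ) : Prop :=
  ∀ (R : ∀ S : Scheme.{0}, CentreSeq S → Prop), OracleFunctional R → OracleAdmissible R →
  ∀ (ν : ℕ → ℕ) (s : MarkedStage.{0}), InScopeM p R 3 ν s → Iso 3 s → dirDim s ≤ 1 →
    NoMovingNearChainFrom R 3 ν s fun _ => True

/-- [OURS · L1 W4.2] **The bridge proper, moving form** (= round 3's `UnitTowerExtraction` / stub-2's `Bridge3` with the hypothesis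
a unit construction actually needs: the marked point is BLOWN UP infinitely often — waiting segments are finite and change no local
ring). [cite: CossartJannsenSaito2020, Def. 6.34, Def. 6.38, Def. 6.39] -/
def UnitTowerExtractionM (p : ℕ) : Prop :=
  ∀ (R : ∀ S : Scheme.{0}, CentreSeq S → Prop), OracleFunctional R → OracleAdmissible R →
  ∀ (ν : ℕ → ℕ) (X : Scheme.{0}) [IsLocallyNoetherian X] (x : X), IsMaximalOrigin p 3 ν X x →
  ∀ c : ℕ → MarkedStage.{0}, Reaches R 3 ν (MarkedStage.init X x) (c 0) →
    (∀ n, CanonicalNearStep R 3 ν (c n) (c (n + 1))) → (∀ n, (c n).geomDirDim ≤ 2) →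
    (∀ n, ∃ m, n ≤ m ∧ (c m).IsBlownUp R 3 ν) → (∀ n, ∃ m, n ≤ m ∧ Iso 3 (c m)) →
    (∀ n, Iso 3 (c n) → dirDim (c n) = 2 ∧ (c n).geomDirDim = 2) →
    ∃ (T : BlowupTower.{0}) (len : ℕ → ℕ) (pt : ∀ i, T.X (unitStart len i)),
      KeySetting T 3 ∧ CharHypothesis (T.X 0) (pt 0) ∧ IsChainOfFundamentalUnits T 3 len pt ∧
      ∀ i, @IsIsolatedInHSMaxLocus (T.X (unitStart len i)) (T.ln _) 3 (pt i)

/-! ### §3c. DROP-IN for the line of record `w_ladder` v4 (landed modules `…Corridor3WLadderDefs` / `…Corridor3WLadder`,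
ns `…Theorems.SigmaMaxModificationsCorridor3.Helpers`): v4 row = MOVING row + `WFair` (proved both ways round), and the MOVING
versions `WA3M` / `WB3M` of `WA3` / `WB3` with `WA3M_of_CJS` (mod L∞), `WB3M_of_rows`, `nuMod_three_of_WAM_WBM` — same downstream
interface as `Helpers.nuMod_three_of_WA_WB`. -/

/-- [OURS · L1 W4.2] **WB, moving**: no MOVING near chain from any maximal origin at level 3. OURS node (cf. CJS LNM 2270
p. 107, Rem. 6.29); not a citation of print; not asserted. -/
def WB3M : Prop :=
  ∀ p : ℕ, p.Prime → MaxOriginNoMovingNearChainAt.{0} p 3 fun _ => True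

/-- [OURS · L1 W4.2] **WA, moving**: the moving maximal-origin statement at level 3 GIVES a `ν`-modification on `{dim ≤ 3}`.
PROVED modulo CJS Thm. 1.2 and L∞ (`WA3M_of_CJS`, companion `…Corridor3WLadderMoving`). OURS node (cf. CJS LNM 2270 Rem. 6.29,
Def. 6.14, Thm. 1.2); not a citation of print; not asserted. -/
def WA3M : Prop :=
  ∀ p : ℕ, p.Prime → (MaxOriginNoMovingNearChainAt.{0} p 3 fun _ => True) →
    ∀ (k : Type) [Field k] [CharP k p] (Y : Scheme.{0})
      (g : Y ⟶ Spec (.of k)), IsSeparated g → LocallyOfFiniteType g → QuasiCompact g →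
      IsReduced Y → topologicalKrullDim Y ≤ ((3 : ℕ) : WithBot ℕ∞) →
      ∀ ν : ℕ → ℕ, Maximal (· ∈ Scheme.hsValues Y 3) ν → ν ≠ iterPSum 3 Phi → TameWild.NuMod Y 3 3 ν

section RowsM

open Summit.ResolutionOfSingularities.ResolutionOfSingularities.Theorems.SigmaMaxModificationsCorridor3.Helpers
  (InScopeC ClosedOriginNoNearChainAt ClosedOriginGeomDirDimNonincrease ClosedOriginNoNearChainAtQ QPerfectResidueField
   QPointed QCharRegime Wlow3Char Wlow3Two Wlow3TwoPerfect Wlow3TwoImperfect Wtop3Pointed Wtop3Nonpointed Bridge3 Bridge3Seq)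

/-! ## §MD. (plan-1, CHAIN v3.7) THE MOVING ROWS BY NAME — the landed §D (`…Corridor3WLadderDefs`) with the ONE-TOKEN change
`NoNearChainFrom ↦ NoMovingNearChainFrom`; the regime cut `QCharRegime p` («`3 ≤ p ∨ dim X ≤ 2`», printed (F1)) and the
pointedness cut `QPointed` are UNCHANGED and still read on the ORIGIN. Joins proved; `WB3M` from the five moving rows
(`WB3M_of_rows5`); the isolation-recurrence cut of §3a restricted to `Q`-origins (ruling (B2)); graded MOVING bridges with the
hypothesis a unit construction needs (the marked point is blown up infinitely often). Every `theorem` is proved; the open content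
is in the `def … : Prop` rows. OURS; NOT statements of the manuscript [Hironaka2017] nor of [CossartJannsenSaito2020]. -/

/-- [OURS · L1 W4.2] `MaxOriginNoMovingNearChainAt` restricted to maximal origins satisfying `Q N ν X x` (moving form of
`Helpers.ClosedOriginNoNearChainAtQ`). [folklore] -/
def MaxOriginNoMovingNearChainAtQ (p N : ℕ) (Q : ℕ → (ℕ → ℕ) → ∀ X : Scheme.{u}, X → Prop)
    (G : MarkedStage.{u} → Prop) : Prop :=
  ∀ (R : ∀ S : Scheme.{u}, CentreSeq S → Prop), OracleFunctional R → OracleAdmissible R →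
  ∀ (ν : ℕ → ℕ) (X : Scheme.{u}) [IsLocallyNoetherian X] (x : X), IsMaximalOrigin p N ν X x → Q N ν X x →
    NoMovingNearChainFrom R N ν (MarkedStage.init X x) G

/-- **ROW W-low-char, MOVING (`stub_Wlow3M_char`)**: in the (F1) regime `QCharRegime p`, no infinite MOVING chain of CONSTANT
grade `ē = e`, `e ≤ 2`, from a maximal origin at level `3` (the printed key theorems' territory: `e = 2` Thm. 6.40 via `Bridge3M` /
the isolation-recurrence cut `UnitTowerExtractionQM`; `e = 1` Cor. 6.37 via `Bridge3SeqM`; `e = 0` no near point).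
[cite: CossartJannsenSaito2020, Thm. 6.40, Cor. 6.37, Thm. 3.14] -/
def Wlow3CharM (p : ℕ) : Prop :=
  ∀ e ≤ 2, MaxOriginNoMovingNearChainAtQ.{u} p 3 (QCharRegime p) fun s => s.geomDirDim = e

/-- **ROW W-low-two, MOVING (`stub_Wlow3M_two`, OURS)**: outside the (F1) regime (for a prime `p`: `p = 2` and `dim X = 3`,
`Helpers.eq_two_of_not_qCharRegime`), no infinite MOVING chain of constant grade `ē = e ≤ 2` from a maximal origin at level `3`.
Helper rows β `Wlow3TwoPerfectM` / γ `Wlow3TwoImperfectM`. [cite: CossartJannsenSaito2020, Thm. 6.40, Thm. 3.14] -/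
def Wlow3TwoM (p : ℕ) : Prop :=
  ∀ e ≤ 2, MaxOriginNoMovingNearChainAtQ.{u} p 3 (fun N ν X x => ¬ QCharRegime p N ν X x) fun s => s.geomDirDim = e

/-- Helper row β of W-low-two, MOVING: perfect residue field at the origin. [cite: CossartJannsenSaito2020, Thm. 3.14, Thm. 6.40] -/
def Wlow3TwoPerfectM (p : ℕ) : Prop :=
  ∀ e ≤ 2, MaxOriginNoMovingNearChainAtQ.{u} p 3
    (fun N ν X x => ¬ QCharRegime p N ν X x ∧ QPerfectResidueField N ν X x) fun s => s.geomDirDim = e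

/-- Helper row γ of W-low-two, MOVING: imperfect residue field at the origin (OPEN; barrier `DirectrixSmallCharacteristic`).
[cite: CossartJannsenSaito2020, Thm. 3.14] -/
def Wlow3TwoImperfectM (p : ℕ) : Prop :=
  ∀ e ≤ 2, MaxOriginNoMovingNearChainAtQ.{u} p 3
    (fun N ν X x => ¬ QCharRegime p N ν X x ∧ ¬ QPerfectResidueField N ν X x) fun s => s.geomDirDim = e

/-- **ROW W-top-pointed, MOVING (`stub_Wtop3M_pointed`)**: no infinite MOVING chain of grade `ē ≥ 3` from a POINTED maximal origin
`X(ν) = {x}` at level `3` (card C′ / `ShadowLaw`; the non-moving door `Helpers.wtop3Pointed_of_tertiaryTerminationAt` still opens it,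
`wtop3PointedM_of_tertiaryTerminationAt`). [cite: CossartJannsenSaito2020, p. 107, §1.3] -/
def Wtop3PointedM (p : ℕ) : Prop :=
  MaxOriginNoMovingNearChainAtQ.{u} p 3 QPointed fun s => 3 ≤ s.geomDirDim

/-- **ROW W-top-nonpointed, MOVING (`stub_Wtop3M_nonpointed`, OPEN — THE CORE)**: no infinite MOVING chain of grade `ē ≥ 3` from a
NON-pointed maximal origin at level `3` (obstruction O2 of CJS §1.3 in maximal-origin, starvation-free form).
[cite: CossartJannsenSaito2020, §1.3, p. 107] -/
def Wtop3NonpointedM (p : ℕ) : Prop :=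
  MaxOriginNoMovingNearChainAtQ.{u} p 3 (fun N ν X x => ¬ QPointed N ν X x) fun s => 3 ≤ s.geomDirDim

/-! ### §MD.2 The isolation-recurrence cut of §3a restricted to `Q`-origins (ruling (B2): the plan INSIDE `Wlow3CharM`) -/

/-- [OURS] `Q`-origin form of the moving-recurrent row. [folklore] -/
def MaxOriginNoMovingRecurrentNearChainAtQ (p N : ℕ) (Q : ℕ → (ℕ → ℕ) → ∀ X : Scheme.{u}, X → Prop)
    (G B : MarkedStage.{u} → Prop) : Prop :=
  ∀ (R : ∀ S : Scheme.{u}, CentreSeq S → Prop), OracleFunctional R → OracleAdmissible R →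
  ∀ (ν : ℕ → ℕ) (X : Scheme.{u}) [IsLocallyNoetherian X] (x : X), IsMaximalOrigin p N ν X x → Q N ν X x →
    NoMovingRecurrentNearChainFrom R N ν (MarkedStage.init X x) G B

/-- [OURS · L1 W4.2] **UNITS-half of `Wlow3CharM`, moving**: in the (F1) regime no moving `ē ≤ 2` chain from a maximal origin is
isolated in the HS-locus infinitely often. [cite: CossartJannsenSaito2020, Thm. 6.40, Def. 6.38] -/
def Wlow3CharUnitsM (p : ℕ) : Prop :=
  MaxOriginNoMovingRecurrentNearChainAtQ.{0} p 3 (QCharRegime p) (fun s => s.geomDirDim ≤ 2) (fun s => Iso 3 s)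

/-- [OURS · L1 W4.2] **STRATA-half of `Wlow3CharM`, moving (= G1′ in the (F1) regime)**: no moving `ē ≤ 2` chain from a maximal
origin in the (F1) regime is non-isolated at EVERY stage. [cite: CossartJannsenSaito2020, Thm. 6.35, Prop. 6.31] -/
def Wlow3CharStrataM (p : ℕ) : Prop :=
  MaxOriginNoMovingNearChainAtQ.{0} p 3 (QCharRegime p) fun s => s.geomDirDim ≤ 2 ∧ ¬ Iso 3 s

/-- [OURS · L1 W4.2] **The unit-tower extraction in the (F1) regime, moving, isolated form** (= §3a `UnitTowerExtractionM` with the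
origin hypothesis `QCharRegime p 3 ν X x` the characteristic hypothesis `CharHypothesis (T.X 0) (pt 0)` needs on `{dim ≤ 3}`; models
(a′) sibling-free unit tower / (b) unit-wise localised chain of ruling (B3) are the two admissible constructions).
[cite: CossartJannsenSaito2020, Def. 6.34, Def. 6.38, Def. 6.39, Thm. 6.40] -/
def UnitTowerExtractionQM (p : ℕ) : Prop :=
  ∀ (R : ∀ S : Scheme.{0}, CentreSeq S → Prop), OracleFunctional R → OracleAdmissible R →
  ∀ (ν : ℕ → ℕ) (X : Scheme.{0}) [IsLocallyNoetherian X] (x : X), IsMaximalOrigin p 3 ν X x → QCharRegime p 3 ν X x →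
  ∀ c : ℕ → MarkedStage.{0}, Reaches R 3 ν (MarkedStage.init X x) (c 0) →
    (∀ n, CanonicalNearStep R 3 ν (c n) (c (n + 1))) → (∀ n, (c n).geomDirDim ≤ 2) →
    (∀ n, ∃ m, n ≤ m ∧ (c m).IsBlownUp R 3 ν) → (∀ n, ∃ m, n ≤ m ∧ Iso 3 (c m)) →
    (∀ n, Iso 3 (c n) → dirDim (c n) = 2 ∧ (c n).geomDirDim = 2) →
    ∃ (T : BlowupTower.{0}) (len : ℕ → ℕ) (pt : ∀ i, T.X (unitStart len i)),
      KeySetting T 3 ∧ CharHypothesis (T.X 0) (pt 0) ∧ IsChainOfFundamentalUnits T 3 len pt ∧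
      ∀ i, @IsIsolatedInHSMaxLocus (T.X (unitStart len i)) (T.ln _) 3 (pt i)

/-! ### §MD.3 Graded MOVING bridges (v4's `Bridge3` / `Bridge3Seq` with the moving hypothesis; strictly weaker obligations) -/

/-- [OURS · L1 W4.2] **The unit bridge at characteristic `p`, MOVING form** (grade exactly `2`, (F1) regime, the marked point blown up
infinitely often): antecedents of `KeyTheorem640_char`. [cite: CossartJannsenSaito2020, Def. 6.38, Def. 6.39, Thm. 6.40] -/
def Bridge3M (p : ℕ) : Prop :=
  ∀ (R : ∀ S : Scheme.{0}, CentreSeq S → Prop), OracleFunctional R → OracleAdmissible R →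
  ∀ (ν : ℕ → ℕ) (X : Scheme.{0}) [IsLocallyNoetherian X] (x : X), IsMaximalOrigin p 3 ν X x → QCharRegime p 3 ν X x →
  ∀ c : ℕ → MarkedStage.{0}, Reaches R 3 ν (MarkedStage.init X x) (c 0) →
    (∀ n, CanonicalNearStep R 3 ν (c n) (c (n + 1))) → (∀ n, (c n).geomDirDim = 2) →
    (∀ n, ∃ m, n ≤ m ∧ (c m).IsBlownUp R 3 ν) →
    ∃ (T : BlowupTower.{0}) (len : ℕ → ℕ) (pt : ∀ i, T.X (unitStart len i)),
      KeySetting T 3 ∧ CharHypothesis (T.X 0) (pt 0) ∧ IsChainOfFundamentalUnits T 3 len pt ∧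
      ∀ i, @NoRegularSubschemeInHSLocus (T.X (unitStart len i)) (T.ln _) 3 (pt i) 1

/-- [OURS · L1 W4.2] **The point-sequence bridge at characteristic `p`, MOVING form** (grade exactly `1`): antecedents of
`Corollary637_char` with `m = ⊤`. [cite: CossartJannsenSaito2020, Def. 6.34, Cor. 6.37] -/
def Bridge3SeqM (p : ℕ) : Prop :=
  ∀ (R : ∀ S : Scheme.{0}, CentreSeq S → Prop), OracleFunctional R → OracleAdmissible R →
  ∀ (ν : ℕ → ℕ) (X : Scheme.{0}) [IsLocallyNoetherian X] (x : X), IsMaximalOrigin p 3 ν X x → QCharRegime p 3 ν X x →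
  ∀ c : ℕ → MarkedStage.{0}, Reaches R 3 ν (MarkedStage.init X x) (c 0) →
    (∀ n, CanonicalNearStep R 3 ν (c n) (c (n + 1))) → (∀ n, (c n).geomDirDim = 1) →
    (∀ n, ∃ m, n ≤ m ∧ (c m).IsBlownUp R 3 ν) →
    ∃ (T : BlowupTower.{0}) (x₀ : T.X 0),
      KeySetting T 3 ∧ CharHypothesis (T.X 0) x₀ ∧ IsFundamentalSequence T 3 x₀ ⊤ ∧
      @IsIsolatedInHSMaxLocus (T.X 0) (T.ln 0) 3 x₀ ∧ T.dirDimAt 0 x₀ = 1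

end RowsM

end Summit.ResolutionOfSingularities.ResolutionOfSingularities.Theorems.SigmaMaxModificationsCorridor3.Moving

end
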